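import Mathlib
import HarnessLib
import Summits.Ventures.LatticeQCDFlow.Exactness.SphereFlowPushforwardDensity
import Summits.Ventures.LatticeQCDFlow.Exactness.SphereLOFlowEffectiveAction

/-!
# The relative entropy of the flowed law to the target is the mean effective action plus the log-partition function, `KL((Φ_{s→c})_*π̄ ‖ e^{−tS}π̄/Z_t) = ∫(tS∘Φ_{s→c} − ℓ_{s→c})dπ̄ + log Z_t`, and for the exact E–S leading-order flow it is at most `(c²/2)·(2κ²/(d−1))·Σ_n(Σ_m‖U_nm‖)²`

HONEST FRAMING: exact (Metropolis-corrected) sampling algorithms for lattice gauge theory;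
figures of merit are autocorrelation/cost numbers at stated couplings and volumes; no
continuum-physics claim.

Venture `LatticeQCDFlow` (cell pub-lqcd), topic `Exactness`; FANOUT row 7 (`s0-cpn-null`: the
S0-D1 rung — 2D CP⁹, Lüscher's LO trivializing map inside HMC, Engel–Schaefer 2011).  NEW WORK of
the cell over the tree's `Exactness/SphereFlowPushforwardDensity.lean` (this leg:
`(Φ_{s→c})_*π̄ = π̄.tilted ℓ_{c→s}`, `∫H∘Φ_{s→c}dπ̄ = ∫e^{ℓ_{c→s}}H dπ̄`),
`Exactness/SphereLOFlowEffectiveAction.lean` (this leg: the E–S LO effective action and its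
pinching) and Mathlib's `InformationTheory.klDiv` / `MeasureTheory.llr` for tilted measures; nothing
is cited as a fact.  Printed counterpart, NAMED ONLY: the reverse Kullback–Leibler objective
`KL(q_θ ‖ p) = E_{z∼r}[S(f_θ(z)) − ln J_θ(z)] + ln Z + const` by which flow-based samplers are
trained and assessed (Albergo–Kanwar–Shanahan 2019 §II; here for the analytic Lüscher/E–S flows, no
training).

* §1 **KL BETWEEN TWO TILTS OF `π̄`** (**`toReal_klDiv_spherePi_tilted_tilted`**): for continuous
  exponents `f, g` on `Ω`,
  `KL(π̄.tilted f ‖ π̄.tilted g) = ∫e^f(f − g)dπ̄/∫e^f dπ̄ − log∫e^f dπ̄ + log∫e^g dπ̄`.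
* §2 **THE RELATIVE ENTROPY OF THE FLOWED LAW** (**`toReal_klDiv_map_sphereTDFlowMap_tilted`**): for
  a jointly `C³` generator, `S ∈ C¹`, real `t`, `|s|, |c| ≤ |T| + 1`:
  `KL((Φ_{s→c})_*π̄ ‖ π̄.tilted(−tS)) = ∫ (tS(Φ_{s→c}ω) − ℓ_{s→c}(ω)) dπ̄(ω) + log ∫e^{−tS}dπ̄`
  — the mean of the effective action `S_eff = tS∘Φ_{s→c} − ℓ_{s→c}` under the a-priori measure plus
  the log-partition function of the target: the exact value of the reverse-KL training objective of
  a flow sampler, for every generator (finite: **`klDiv_map_sphereTDFlowMap_tilted_ne_top`**).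
* §3 **THE EXACT LO FLOW** (**`toReal_klDiv_map_loFlow_le`**): for the E–S action (`d ≥ 2`, no
  self-coupling, adjoint pairs) and `0 ≤ c ≤ |T| + 1`,
  `KL((Φ_{0→c})_*π̄ ‖ e^{−cS}π̄/Z_c) ≤ (c²/2)·(2κ²/(d−1))·Σ_n(Σ_m‖U_nm‖)²` — linear in the volume at
  fixed flow time and coupling (`S_eff ≤ cS₀` pointwise and `Z_c ≤ e^{−cS₀+(c²/2)M}`).

NOT CLAIMED: a lower bound on this relative entropy beyond `0`; the forward KL; anything about
trained (non-analytic) flows, acceptance rates, autocorrelations or the rung's numbers.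
-/

noncomputable section

namespace Summit.Ventures.LatticeQCDFlow.Exactness

open Function Set Metric MeasureTheory NormedSpace InnerProductSpace InformationTheory
open scoped RealInnerProductSpace Topology

variable {Λ : Type*} {E : Type*} [NormedAddCommGroup E] [InnerProductSpace ℝ E]
  [FiniteDimensional ℝ E] [Fintype Λ] [DecidableEq Λ] [MeasurableSpace E] [BorelSpace E]
  [Nontrivial E]

/-! ## §1 Relative entropy between two tilts of the product measure -/

omit [DecidableEq Λ] in
/-- **KL BETWEEN TWO TILTS OF `π̄` BY CONTINUOUS EXPONENTS**:
`KL(π̄.tilted f ‖ π̄.tilted g) = ∫e^f(f − g)dπ̄/∫e^f dπ̄ − log∫e^f dπ̄ + log∫e^g dπ̄`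
(Mathlib's log-likelihood ratio of tilted measures; both tilts are probability measures, mutually
absolutely continuous with `π̄`). -/
theorem toReal_klDiv_spherePi_tilted_tilted {f g : (Λ → sphere (0 : E) 1) → ℝ} (hf : Continuous f)
    (hg : Continuous g) :
    (klDiv ((Measure.pi (fun _ : Λ => uniformSphere (volume : Measure E))).tilted f)
        ((Measure.pi (fun _ : Λ => uniformSphere (volume : Measure E))).tilted g)).toReal =
      (∫ ω, Real.exp (f ω) * (f ω - g ω) ∂Measure.pi (fun _ : Λ => uniformSphere (volume : Measure E))) /
          (∫ ω, Real.exp (f ω) ∂Measure.pi (fun _ : Λ => uniformSphere (volume : Measure E))) -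
        Real.log (∫ ω, Real.exp (f ω) ∂Measure.pi (fun _ : Λ => uniformSphere (volume : Measure E))) +
        Real.log (∫ ω, Real.exp (g ω) ∂Measure.pi (fun _ : Λ => uniformSphere (volume : Measure E))) := by
  have hef : Integrable (fun ω => Real.exp (f ω))
      (Measure.pi (fun _ : Λ => uniformSphere (volume : Measure E))) :=
    integrable_pi_of_continuous _ (Real.continuous_exp.comp hf)
  have heg : Integrable (fun ω => Real.exp (g ω))
      (Measure.pi (fun _ : Λ => uniformSphere (volume : Measure E))) :=
    integrable_pi_of_continuous _ (Real.continuous_exp.comp hg)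
  haveI : IsProbabilityMeasure
      ((Measure.pi (fun _ : Λ => uniformSphere (volume : Measure E))).tilted f) :=
    isProbabilityMeasure_tilted hef
  haveI : IsProbabilityMeasure
      ((Measure.pi (fun _ : Λ => uniformSphere (volume : Measure E))).tilted g) :=
    isProbabilityMeasure_tilted heg
  have hπg : Measure.pi (fun _ : Λ => uniformSphere (volume : Measure E)) ≪
      (Measure.pi (fun _ : Λ => uniformSphere (volume : Measure E))).tilted g :=
    absolutelyContinuous_tilted heg
  have hac : (Measure.pi (fun _ : Λ => uniformSphere (volume : Measure E))).tilted f ≪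
      (Measure.pi (fun _ : Λ => uniformSphere (volume : Measure E))).tilted g :=
    (tilted_absolutelyContinuous _ f).trans hπg
  rw [toReal_klDiv_of_measure_eq hac (by simp only [measure_univ])]
  -- the log-likelihood ratio, `π̄`-a.e. and hence `π̄.tilted f`-a.e.
  have h1 := llr_tilted_left (f := f) hπg hef hf.measurable.aemeasurable
  have h2 := llr_tilted_right (μ := Measure.pi (fun _ : Λ => uniformSphere (volume : Measure E)))
    (f := g) Measure.AbsolutelyContinuous.rfl heg
  have h3 := llr_self (Measure.pi (fun _ : Λ => uniformSphere (volume : Measure E)))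
  have hall : llr ((Measure.pi (fun _ : Λ => uniformSphere (volume : Measure E))).tilted f)
      ((Measure.pi (fun _ : Λ => uniformSphere (volume : Measure E))).tilted g)
      =ᵐ[Measure.pi (fun _ : Λ => uniformSphere (volume : Measure E))] fun ω =>
      (f ω - g ω) +
        (Real.log (∫ z, Real.exp (g z) ∂Measure.pi (fun _ : Λ => uniformSphere (volume : Measure E))) -
          Real.log (∫ z, Real.exp (f z) ∂Measure.pi (fun _ : Λ => uniformSphere (volume : Measure E)))) := by
    filter_upwards [h1, h2, h3] with ω hω1 hω2 hω3
    rw [hω1, hω2, hω3, Pi.zero_apply]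
    ring
  rw [integral_congr_ae ((tilted_absolutelyContinuous _ f).ae_le hall), integral_spherePi_tilted]
  -- evaluate the tilted integral of `(f − g) + const`
  have hi1 : Integrable (fun ω => Real.exp (f ω) * (f ω - g ω))
      (Measure.pi (fun _ : Λ => uniformSphere (volume : Measure E))) :=
    integrable_pi_of_continuous _ ((Real.continuous_exp.comp hf).mul (hf.sub hg))
  have hi2 : Integrable (fun ω => Real.exp (f ω) *
      (Real.log (∫ z, Real.exp (g z) ∂Measure.pi (fun _ : Λ => uniformSphere (volume : Measure E))) -
        Real.log (∫ z, Real.exp (f z) ∂Measure.pi (fun _ : Λ => uniformSphere (volume : Measure E)))))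
      (Measure.pi (fun _ : Λ => uniformSphere (volume : Measure E))) :=
    hef.mul_const _
  have hsplit : (fun ω => Real.exp (f ω) * ((f ω - g ω) +
      (Real.log (∫ z, Real.exp (g z) ∂Measure.pi (fun _ : Λ => uniformSphere (volume : Measure E))) -
        Real.log (∫ z, Real.exp (f z) ∂Measure.pi (fun _ : Λ => uniformSphere (volume : Measure E)))))) =
      fun ω => Real.exp (f ω) * (f ω - g ω) + Real.exp (f ω) *
        (Real.log (∫ z, Real.exp (g z) ∂Measure.pi (fun _ : Λ => uniformSphere (volume : Measure E))) -
          Real.log (∫ z, Real.exp (f z) ∂Measure.pi (fun _ : Λ => uniformSphere (volume : Measure E)))) := by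
    funext ω; ring
  rw [hsplit, integral_add hi1 hi2, integral_mul_const]
  have hZ : (∫ ω, Real.exp (f ω) ∂Measure.pi (fun _ : Λ => uniformSphere (volume : Measure E))) ≠ 0 :=
    (integral_exp_pos hef).ne'
  have key : ∀ A Zf Lf Lg : ℝ, Zf ≠ 0 → (A + Zf * (Lg - Lf)) / Zf = A / Zf - Lf + Lg := by
    intro A Zf Lf Lg h
    field_simp
    ring
  exact key _ _ _ _ hZ

/-! ## §2 The relative entropy of the flowed law to a tilted target -/

variable {G : ℝ → (Λ → E) → ℝ} {T : ℝ}

/-- **THE RELATIVE ENTROPY OF THE FLOWED LAW IS THE MEAN EFFECTIVE ACTION PLUS THE LOG-PARTITION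
FUNCTION.**  For a jointly `C³` generator, `S ∈ C¹`, real `t` and `|s|, |c| ≤ |T| + 1`:
`KL((Φ_{s→c})_*π̄ ‖ π̄.tilted(−tS)) = ∫ (t·S(Φ_{s→c}ω) − ℓ_{s→c}(ω)) dπ̄(ω) + log ∫ e^{−tS} dπ̄`
— with `S_eff = tS∘Φ_{s→c} − ℓ_{s→c}` the exact effective action, `E_π̄[S_eff] + log Z_t`: the
reverse-KL objective of flow samplers, in closed form for every generator. -/
theorem toReal_klDiv_map_sphereTDFlowMap_tilted
    (hG : ContDiff ℝ 2 fun q : ℝ × (Λ → E) => G q.1 q.2)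
    (hG3 : ContDiff ℝ 3 fun q : ℝ × (Λ → E) => G q.1 q.2) {S : (Λ → E) → ℝ} (hS : ContDiff ℝ 1 S)
    (t : ℝ) {s c : ℝ} (hs : |s| ≤ |T| + 1) (hc : |c| ≤ |T| + 1) :
    (klDiv (Measure.map (sphereTDFlowMap hG T s c)
          (Measure.pi (fun _ : Λ => uniformSphere (volume : Measure E))))
        ((Measure.pi (fun _ : Λ => uniformSphere (volume : Measure E))).tilted
          fun ω => -(t * S (fun m => (ω m : E))))).toReal =
      (∫ ω, (t * S (sphereTDFlow hG T s c (fun m => ((ω : Λ → sphere (0 : E) 1) m : E))) -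
          sphereTDFlowLogJac hG T s c (fun m => (ω m : E)))
          ∂Measure.pi (fun _ : Λ => uniformSphere (volume : Measure E))) +
        Real.log (∫ ω, Real.exp (-(t * S (fun m => ((ω : Λ → sphere (0 : E) 1) m : E))))
          ∂Measure.pi (fun _ : Λ => uniformSphere (volume : Measure E))) := by
  have hf : Continuous fun ω : Λ → sphere (0 : E) 1 =>
      sphereTDFlowLogJac hG T c s (fun m => (ω m : E)) :=
    continuous_sphereTDFlowLogJac_sphereConfig hG hG3 c s
  have hg : Continuous fun ω : Λ → sphere (0 : E) 1 => -(t * S (fun m => (ω m : E))) :=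
    (continuous_const.mul (hS.continuous.comp continuous_sphereConfig)).neg
  rw [map_sphereTDFlowMap_spherePi_eq_tilted_logJac hG hG3 hs hc,
    toReal_klDiv_spherePi_tilted_tilted hf hg, integral_exp_sphereTDFlowLogJac hG hG3 hc hs,
    div_one, Real.log_one, sub_zero]
  congr 1
  -- `∫ e^{ℓ_{c→s}}(ℓ_{c→s} + tS) dπ̄ = ∫ (ℓ_{c→s} + tS)∘Φ_{s→c} dπ̄ = ∫ (tS∘Φ_{s→c} − ℓ_{s→c}) dπ̄`
  have hH : ContDiff ℝ 1 fun z : Λ → E => sphereTDFlowLogJac hG T c s z - -(t * S z) :=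
    (contDiff_sphereTDFlowLogJac_apply hG hG3 c s (T := T)).sub (contDiff_const.mul hS).neg
  have h := integral_comp_sphereTDFlow_eq_integral_exp_logJac_mul hG hG3 hH hs hc (T := T)
  rw [← h]
  refine integral_congr_ae (ae_of_all _ fun ω => ?_)
  simp only [sphereTDFlowLogJac_symm hG hG3 s c]
  ring

omit [DecidableEq Λ] in
/-- The relative entropy between two tilts of `π̄` by continuous exponents is finite (the
log-likelihood ratio is a.e. a continuous function on the compact `Ω`). -/
theorem klDiv_spherePi_tilted_tilted_ne_top {f g : (Λ → sphere (0 : E) 1) → ℝ} (hf : Continuous f)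
    (hg : Continuous g) :
    klDiv ((Measure.pi (fun _ : Λ => uniformSphere (volume : Measure E))).tilted f)
        ((Measure.pi (fun _ : Λ => uniformSphere (volume : Measure E))).tilted g) ≠ ⊤ := by
  have hef : Integrable (fun ω => Real.exp (f ω))
      (Measure.pi (fun _ : Λ => uniformSphere (volume : Measure E))) :=
    integrable_pi_of_continuous _ (Real.continuous_exp.comp hf)
  have heg : Integrable (fun ω => Real.exp (g ω))
      (Measure.pi (fun _ : Λ => uniformSphere (volume : Measure E))) :=
    integrable_pi_of_continuous _ (Real.continuous_exp.comp hg)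
  haveI : IsProbabilityMeasure
      ((Measure.pi (fun _ : Λ => uniformSphere (volume : Measure E))).tilted f) :=
    isProbabilityMeasure_tilted hef
  have hπg : Measure.pi (fun _ : Λ => uniformSphere (volume : Measure E)) ≪
      (Measure.pi (fun _ : Λ => uniformSphere (volume : Measure E))).tilted g :=
    absolutelyContinuous_tilted heg
  have hac : (Measure.pi (fun _ : Λ => uniformSphere (volume : Measure E))).tilted f ≪
      (Measure.pi (fun _ : Λ => uniformSphere (volume : Measure E))).tilted g :=
    (tilted_absolutelyContinuous _ f).trans hπg
  refine klDiv_ne_top hac ?_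
  have h1 := llr_tilted_left (f := f) hπg hef hf.measurable.aemeasurable
  have h2 := llr_tilted_right (μ := Measure.pi (fun _ : Λ => uniformSphere (volume : Measure E)))
    (f := g) Measure.AbsolutelyContinuous.rfl heg
  have h3 := llr_self (Measure.pi (fun _ : Λ => uniformSphere (volume : Measure E)))
  have hall : llr ((Measure.pi (fun _ : Λ => uniformSphere (volume : Measure E))).tilted f)
      ((Measure.pi (fun _ : Λ => uniformSphere (volume : Measure E))).tilted g)
      =ᵐ[Measure.pi (fun _ : Λ => uniformSphere (volume : Measure E))] fun ω =>
      (f ω - g ω) +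
        (Real.log (∫ z, Real.exp (g z) ∂Measure.pi (fun _ : Λ => uniformSphere (volume : Measure E))) -
          Real.log (∫ z, Real.exp (f z) ∂Measure.pi (fun _ : Λ => uniformSphere (volume : Measure E)))) := by
    filter_upwards [h1, h2, h3] with ω hω1 hω2 hω3
    rw [hω1, hω2, hω3, Pi.zero_apply]
    ring
  have hcont : Continuous fun ω : Λ → sphere (0 : E) 1 => (f ω - g ω) +
      (Real.log (∫ z, Real.exp (g z) ∂Measure.pi (fun _ : Λ => uniformSphere (volume : Measure E))) -
        Real.log (∫ z, Real.exp (f z) ∂Measure.pi (fun _ : Λ => uniformSphere (volume : Measure E)))) :=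
    (hf.sub hg).add continuous_const
  have hi : Integrable (fun ω : Λ → sphere (0 : E) 1 => (f ω - g ω) +
      (Real.log (∫ z, Real.exp (g z) ∂Measure.pi (fun _ : Λ => uniformSphere (volume : Measure E))) -
        Real.log (∫ z, Real.exp (f z) ∂Measure.pi (fun _ : Λ => uniformSphere (volume : Measure E)))))
      ((Measure.pi (fun _ : Λ => uniformSphere (volume : Measure E))).tilted f) :=
    hcont.integrable_of_hasCompactSupport (HasCompactSupport.of_compactSpace _)
  have hall' : llr ((Measure.pi (fun _ : Λ => uniformSphere (volume : Measure E))).tilted f)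
      ((Measure.pi (fun _ : Λ => uniformSphere (volume : Measure E))).tilted g)
      =ᵐ[(Measure.pi (fun _ : Λ => uniformSphere (volume : Measure E))).tilted f] fun ω =>
      (f ω - g ω) +
        (Real.log (∫ z, Real.exp (g z) ∂Measure.pi (fun _ : Λ => uniformSphere (volume : Measure E))) -
          Real.log (∫ z, Real.exp (f z) ∂Measure.pi (fun _ : Λ => uniformSphere (volume : Measure E)))) :=
    (tilted_absolutelyContinuous _ f).ae_le hall
  exact hi.congr hall'.symm

/-- The relative entropy of the flowed law to a tilted target is finite. -/
theorem klDiv_map_sphereTDFlowMap_tilted_ne_top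
    (hG : ContDiff ℝ 2 fun q : ℝ × (Λ → E) => G q.1 q.2)
    (hG3 : ContDiff ℝ 3 fun q : ℝ × (Λ → E) => G q.1 q.2) {S : (Λ → E) → ℝ} (hS : ContDiff ℝ 1 S)
    (t : ℝ) {s c : ℝ} (hs : |s| ≤ |T| + 1) (hc : |c| ≤ |T| + 1) :
    klDiv (Measure.map (sphereTDFlowMap hG T s c)
          (Measure.pi (fun _ : Λ => uniformSphere (volume : Measure E))))
        ((Measure.pi (fun _ : Λ => uniformSphere (volume : Measure E))).tilted
          fun ω => -(t * S (fun m => (ω m : E)))) ≠ ⊤ := by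
  rw [map_sphereTDFlowMap_spherePi_eq_tilted_logJac hG hG3 hs hc]
  exact klDiv_spherePi_tilted_tilted_ne_top (continuous_sphereTDFlowLogJac_sphereConfig hG hG3 c s)
    (continuous_const.mul (hS.continuous.comp continuous_sphereConfig)).neg

/-! ## §3 The exact leading-order flow: relative entropy linear in the volume -/

variable {U : Λ → Λ → (E →L[ℝ] E)}

/-- **THE RELATIVE ENTROPY OF THE EXACT LO FLOW IS AT MOST `(c²/2)·M`.**  For the E–S action
(`d ≥ 2`, no self-coupling, adjoint pairs), the exact flow `Φ` of the constant generator `S̃⁽⁰⁾` and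
`0 ≤ c ≤ |T| + 1`:
`KL((Φ_{0→c})_*π̄ ‖ π̄.tilted(−cS)) ≤ (c²/2)·(2κ²/(d−1))·Σ_n(Σ_m‖U_nm‖)²`
(mean effective action `≤ cS₀`, log-partition function `≤ −cS₀ + (c²/2)M`). -/
theorem toReal_klDiv_map_loFlow_le (hU0 : ∀ n, U n n = 0)
    (hUadj : ∀ m n (v w : E), ⟪U m n v, w⟫ = ⟪v, U n m w⟫) (hd : 2 ≤ Module.finrank ℝ E)
    (κ S₀ : ℝ) {c : ℝ} (hc0 : 0 ≤ c) (hc : c ≤ |T| + 1) :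
    (klDiv (Measure.map (sphereTDFlowMap (G := fun _ : ℝ => loFlowAction κ S₀ U)
          (contDiff_const_family (contDiff_loFlowAction U κ S₀)) T 0 c)
          (Measure.pi (fun _ : Λ => uniformSphere (volume : Measure E))))
        ((Measure.pi (fun _ : Λ => uniformSphere (volume : Measure E))).tilted
          fun ω => -(c * esAction κ S₀ U (fun m => (ω m : E))))).toReal ≤
      c ^ 2 / 2 * (2 * κ ^ 2 / ((Module.finrank ℝ E : ℝ) - 1) * ∑ n, (∑ m, ‖U n m‖) ^ 2) := by
  have hc' : |c| ≤ |T| + 1 := by rwa [abs_of_nonneg hc0]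
  have h0 : |(0 : ℝ)| ≤ |T| + 1 := by rw [abs_zero]; positivity
  rw [toReal_klDiv_map_sphereTDFlowMap_tilted _ (contDiff_const_family (contDiff_loFlowAction U κ S₀))
    (contDiff_esAction U κ S₀) c h0 hc']
  -- the mean effective action is at most `c S₀`
  have hSeff : ∀ ω : Λ → sphere (0 : E) 1,
      c * esAction κ S₀ U (sphereTDFlow (G := fun _ : ℝ => loFlowAction κ S₀ U)
          (contDiff_const_family (contDiff_loFlowAction U κ S₀)) T 0 c (fun m => (ω m : E))) -
        sphereTDFlowLogJac (G := fun _ : ℝ => loFlowAction κ S₀ U)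
          (contDiff_const_family (contDiff_loFlowAction U κ S₀)) T 0 c (fun m => (ω m : E)) ≤ c * S₀ :=
    fun ω => (effAction_loFlow_mem_Icc hU0 hUadj hd κ S₀ (norm_sphereConfig_eq_one ω) hc0 hc (T := T)).2
  have h1 := (((contDiff_esAction U κ S₀ (m := 1)).comp (contDiff_sphereTDFlow_apply
    (G := fun _ : ℝ => loFlowAction κ S₀ U) (contDiff_const_family (contDiff_loFlowAction U κ S₀))
    0 c (T := T))).continuous).comp continuous_sphereConfig
  have h2 := continuous_sphereTDFlowLogJac_sphereConfig (G := fun _ : ℝ => loFlowAction κ S₀ U)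
    (contDiff_const_family (contDiff_loFlowAction U κ S₀))
    (contDiff_const_family (contDiff_loFlowAction U κ S₀)) 0 c (T := T)
  have hcont : Continuous fun ω : Λ → sphere (0 : E) 1 =>
      c * esAction κ S₀ U (sphereTDFlow (G := fun _ : ℝ => loFlowAction κ S₀ U)
          (contDiff_const_family (contDiff_loFlowAction U κ S₀)) T 0 c (fun m => (ω m : E))) -
        sphereTDFlowLogJac (G := fun _ : ℝ => loFlowAction κ S₀ U)
          (contDiff_const_family (contDiff_loFlowAction U κ S₀)) T 0 c (fun m => (ω m : E)) :=
    (continuous_const.mul h1).sub h2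
  have hmean : ∫ ω, (c * esAction κ S₀ U (sphereTDFlow (G := fun _ : ℝ => loFlowAction κ S₀ U)
          (contDiff_const_family (contDiff_loFlowAction U κ S₀)) T 0 c
            (fun m => ((ω : Λ → sphere (0 : E) 1) m : E))) -
        sphereTDFlowLogJac (G := fun _ : ℝ => loFlowAction κ S₀ U)
          (contDiff_const_family (contDiff_loFlowAction U κ S₀)) T 0 c (fun m => (ω m : E)))
        ∂Measure.pi (fun _ : Λ => uniformSphere (volume : Measure E)) ≤ c * S₀ := by
    have h := integral_mono (integrable_pi_of_continuous (uniformSphere (volume : Measure E)) hcont)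
      (integrable_const (c * S₀)) hSeff
    simp only [integral_const, smul_eq_mul, probReal_univ, one_mul] at h
    exact h
  -- the partition function is at most `e^{−cS₀ + (c²/2)M}`
  have hwc : Continuous fun ω : Λ → sphere (0 : E) 1 =>
      Real.exp (sphereTDFlowLogJac (G := fun _ : ℝ => loFlowAction κ S₀ U)
        (contDiff_const_family (contDiff_loFlowAction U κ S₀)) T 0 c (fun m => (ω m : E)) -
        c * esAction κ S₀ U (sphereTDFlow (G := fun _ : ℝ => loFlowAction κ S₀ U)
          (contDiff_const_family (contDiff_loFlowAction U κ S₀)) T 0 c (fun m => (ω m : E)))) :=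
    Real.continuous_exp.comp (h2.sub (continuous_const.mul h1))
  have hZ : ∫ ω, Real.exp (-(c * esAction κ S₀ U (fun m => ((ω : Λ → sphere (0 : E) 1) m : E))))
      ∂Measure.pi (fun _ : Λ => uniformSphere (volume : Measure E)) ≤
      Real.exp (-(c * S₀) + c ^ 2 / 2 *
        (2 * κ ^ 2 / ((Module.finrank ℝ E : ℝ) - 1) * ∑ n, (∑ m, ‖U n m‖) ^ 2)) := by
    have hw := integral_loWeight_mul_comp_eq (U := U) κ S₀ (contDiff_const (c := (1 : ℝ))) hc' (T := T)
    simp only [mul_one] at hw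
    rw [← hw]
    have h := integral_mono (integrable_pi_of_continuous (uniformSphere (volume : Measure E)) hwc)
      (integrable_const (Real.exp (-(c * S₀) + c ^ 2 / 2 *
        (2 * κ ^ 2 / ((Module.finrank ℝ E : ℝ) - 1) * ∑ n, (∑ m, ‖U n m‖) ^ 2))))
      fun ω => (loWeight_mem_Icc hU0 hUadj hd κ S₀ hc0 hc ω (T := T)).2
    simp only [integral_const, smul_eq_mul, probReal_univ, one_mul] at h
    exact h
  have hZpos : 0 < ∫ ω, Real.exp (-(c * esAction κ S₀ U
      (fun m => ((ω : Λ → sphere (0 : E) 1) m : E)))) ∂Measure.pi (fun _ : Λ => uniformSphere (volume : Measure E)) :=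
    integral_exp_neg_mul_pos (Λ := Λ) (contDiff_esAction U κ S₀ (m := 0)).continuous c
  have hlog := (Real.log_le_iff_le_exp hZpos).2 hZ
  linarith

end Summit.Ventures.LatticeQCDFlow.Exactness

end
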